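import Summits.ValiantsHypothesis.ValiantsHypothesis.Theorems.KPlusLogSqLawTropicalBSplitDefs
import Summits.ValiantsHypothesis.ValiantsHypothesis.Theorems.LacunarySymmetroidMatrixDescartesCensusTropicalKLawStatic
import Summits.ValiantsHypothesis.ValiantsHypothesis.Theorems.KPlusLogSqLawTropicalBSplitGlue

/-!
# Route `KPlusLogSqLaw`, crux `TropicalB` (stmt-ValiantsHypothesis-19771) — COLUMN FAN-OUT, part 1: the WALKS of the fan-out gadget
# (structure of present covers; existence and uniqueness of the walk of a permutation)

HONEST FRAMING.  Helper file (seat val-sym-trop-p1 g14, cell `pub-symmetroid`, 2026-08-28) toward the registered stubs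
`stub_tropThin` / `stub_tropFat` of `Cruxes/TropicalB/Lines/birth.lean` (crux
`Summit.ValiantsHypothesis.ValiantsHypothesis.Theses.KPlusLogSqLaw.TropicalB`, item `stmt-ValiantsHypothesis-19771`, route
`KPlusLogSqLaw`; `--supports … --as helper`).  Pure combinatorics of permutations of `Fin m × Fin (m+1)` used by the degree-3 normal form
(`…TropicalBColumnFanout`, part 3): nothing here mentions a design; nothing bears on `TropicalB` in its window, `WeakLifting`, the doors,
`MatrixDescartes` (stmt-ValiantsHypothesis-18050) or VP ≠ VNP.

THE GADGET.  Column `j` of an `m × m` design is fanned out along DECISION VERTICES `(j,1), …, (j,m)` above the original vertex `(j,0)`: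
the cover of a term `(σ,λ)` walks `(j,0) → (j,1) → ⋯ → (j, σ j + 1) → (σ j, 0)` (EXIT to the original row `σ j`) and idles the decision
vertices above the exit.  This file: `structure_of_cases` (a permutation all of whose columns make admissible moves — start, exit,
continue, idle — is such a system of walks for a unique exit permutation `σ`: a decision vertex whose row is entered must move, a moving
vertex forces all lower ones to continue, two exits in one column group are impossible, the exits biject groups with original rows),
`desc_unique` / `sigma_unique` (the walk description determines the permutation and the exit permutation), `desc_exists` (the walk of
every `σ` exists: an explicit successor function is injective).  [folklore] (gadget bookkeeping).
-/

set_option linter.dupNamespace false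
set_option autoImplicit false

namespace Summit.ValiantsHypothesis.ValiantsHypothesis.Theorems.KPlusLogSqLaw

open Summit.ValiantsHypothesis.ValiantsHypothesis.Theorems.MatrixDescartes.Negative
open Summit.ValiantsHypothesis.ValiantsHypothesis.Theorems.LacunarySymmetroidMatrixDescartes
open scoped BigOperators
open Finset

namespace ColumnFanout

variable {m K : ℕ}

/-! ## 1. Structure of the present covers of the fan-out design -/

/-- **Structure of a present cover.**  Let `S` be a permutation of `Fin m × Fin (m+1)` every column of which follows one of the four
admissible moves of the fan-out design — `(j,0) ↦ (j,1)`; EXIT `(j,t) ↦ (t−1, 0)`; CONTINUE `(j,t) ↦ (j,t+1)`; IDLE `(j,t) ↦ (j,t)`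
(`t ≠ 0` in the last three).  Then there is a permutation `σ` of `Fin m` such that every column group `j` walks
`(j,0) → (j,1) → ⋯ → (j, σ j + 1) → (σ j, 0)` and idles above. [folklore] -/
theorem structure_of_cases (S : Equiv.Perm (Fin m × Fin (m + 1)))
    (hcase : ∀ c : Fin m × Fin (m + 1),
      ((c.2 : ℕ) = 0 ∧ (S c).1 = c.1 ∧ ((S c).2 : ℕ) = 1) ∨
      ((c.2 : ℕ) ≠ 0 ∧ ((S c).2 : ℕ) = 0 ∧ ((S c).1 : ℕ) + 1 = (c.2 : ℕ)) ∨
      ((c.2 : ℕ) ≠ 0 ∧ (S c).1 = c.1 ∧ ((S c).2 : ℕ) = (c.2 : ℕ) + 1) ∨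
      ((c.2 : ℕ) ≠ 0 ∧ S c = c)) :
    ∃ σ : Equiv.Perm (Fin m), ∀ j : Fin m, ∀ t : Fin (m + 1),
      ((t : ℕ) = 0 → (S (j, t)).1 = j ∧ ((S (j, t)).2 : ℕ) = 1) ∧
      ((t : ℕ) ≠ 0 → (t : ℕ) ≤ (σ j : ℕ) → (S (j, t)).1 = j ∧ ((S (j, t)).2 : ℕ) = (t : ℕ) + 1) ∧
      ((t : ℕ) = (σ j : ℕ) + 1 → S (j, t) = (σ j, 0)) ∧
      ((σ j : ℕ) + 1 < (t : ℕ) → S (j, t) = (j, t)) := by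
  -- (a) who enters the row `(j, t')` with `t' ≠ 0`: the column below it (moving up) or the row itself (idling)
  have hrow : ∀ (j : Fin m) (t' : Fin (m + 1)), (t' : ℕ) ≠ 0 →
      (∃ t : Fin (m + 1), (t : ℕ) + 1 = (t' : ℕ) ∧ S (j, t) = (j, t')) ∨ S (j, t') = (j, t') := by
    intro j t' ht'
    obtain ⟨c, hc⟩ := S.surjective (j, t')
    rcases hcase c with ⟨h1, h2, h3⟩ | ⟨h1, h2, h3⟩ | ⟨h1, h2, h3⟩ | ⟨h1, h2⟩
    · left
      refine ⟨c.2, ?_, ?_⟩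
      · rw [hc] at h3; dsimp only at h3; omega
      · have : c = (j, c.2) := by
          rw [hc] at h2; exact Prod.ext h2.symm rfl
        rw [← this, hc]
    · rw [hc] at h2; dsimp only at h2; exact absurd h2 ht'
    · left
      refine ⟨c.2, ?_, ?_⟩
      · rw [hc] at h3; dsimp only at h3; omega
      · have : c = (j, c.2) := by
          rw [hc] at h2; exact Prod.ext h2.symm rfl
        rw [← this, hc]
    · right
      have hcc : c = (j, t') := h2.symm.trans hc
      rw [← hcc]
      exact h2
  -- the moves, as predicates on a column `(j, t)`
  -- (b) if column `(j, t)` moves up to `(j, t')`, then `(j, t')` does not idle (injectivity)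
  have hnot_idle_of_up : ∀ (j : Fin m) (t t' : Fin (m + 1)), S (j, t) = (j, t') → t ≠ t' → S (j, t') ≠ (j, t') := by
    intro j t t' h hne h'
    have := S.injective (h.trans h'.symm)
    exact hne (congrArg Prod.snd this)
  -- (c) ACTIVE PROPAGATES DOWN: if column `(j, t')` with `t' ≥ 1` is not idle then every column `(j, t)` with `1 ≤ t < t'` continues
  have hdown : ∀ (j : Fin m) (k : ℕ) (t t' : Fin (m + 1)), (t : ℕ) + 1 + k = (t' : ℕ) → 1 ≤ (t : ℕ) →
      S (j, t') ≠ (j, t') → (S (j, t)).1 = j ∧ ((S (j, t)).2 : ℕ) = (t : ℕ) + 1 := by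
    intro j k
    induction k with
    | zero =>
      intro t t' htt ht hact
      rcases hrow j t' (by omega) with ⟨t₀, ht₀, hS⟩ | hidle
      · have : t₀ = t := Fin.ext (by omega)
        subst this
        rw [hS]
        exact ⟨rfl, by show ((t' : Fin (m + 1)) : ℕ) = (t₀ : ℕ) + 1; omega⟩
      · exact absurd hidle hact
    | succ k ih =>
      intro t t' htt ht hact
      -- the column just below `t'`
      have hlt : (t : ℕ) + 1 < m + 1 := by have := t'.isLt; omega
      set t₁ : Fin (m + 1) := ⟨(t : ℕ) + 1, hlt⟩ with ht₁
      have h1 := ih t₁ t' (by simp [ht₁]; omega) (by simp [ht₁]) hact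
      -- `t₁` continues, hence is not idle... we need: column `t` moves up to `t₁`
      have hact₁ : S (j, t₁) ≠ (j, t₁) := by
        intro h
        have := congrArg (fun x => ((x.2 : Fin (m + 1)) : ℕ)) h
        simp only at this
        omega
      rcases hrow j t₁ (by simp [ht₁]) with ⟨t₀, ht₀, hS⟩ | hidle
      · have : t₀ = t := Fin.ext (by simp [ht₁] at ht₀; omega)
        subst this
        rw [hS]
        exact ⟨rfl, by show ((t₁ : Fin (m + 1)) : ℕ) = (t₀ : ℕ) + 1; simp [ht₁]⟩
      · exact absurd hidle hact₁
  -- (d) the exits: the column entering the original row `(i, 0)`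
  have hexit : ∀ i : Fin m, ((S.symm (i, 0)).2 : ℕ) ≠ 0 ∧ ((S.symm (i, 0)).2 : ℕ) = (i : ℕ) + 1 := by
    intro i
    set c := S.symm (i, 0) with hc
    have hSc : S c = (i, 0) := by rw [hc, Equiv.apply_symm_apply]
    rcases hcase c with ⟨_, _, h3⟩ | ⟨h1, _, h3⟩ | ⟨_, _, h3⟩ | ⟨h1, h2⟩
    · rw [hSc] at h3; dsimp only at h3; simp at h3
    · rw [hSc] at h3; dsimp only at h3; exact ⟨h1, h3.symm⟩
    · rw [hSc] at h3; dsimp only at h3; simp only [Fin.val_zero] at h3; omega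
    · exfalso
      have hc0 : c = (i, 0) := h2.symm.trans hSc
      have : (c.2 : ℕ) = 0 := by rw [hc0]; simp
      exact h1 this
  -- the group exiting to row `i`
  set τ : Fin m → Fin m := fun i => (S.symm (i, 0)).1 with hτ
  have hτS : ∀ i : Fin m, S (τ i, ⟨(i : ℕ) + 1, by omega⟩) = (i, 0) := by
    intro i
    have h := hexit i
    have hc : S.symm (i, 0) = (τ i, ⟨(i : ℕ) + 1, by omega⟩) := Prod.ext rfl (Fin.ext h.2)
    rw [← hc, Equiv.apply_symm_apply]
  have hτinj : Function.Injective τ := by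
    intro i i' h
    by_contra hne
    -- two exits in the same group: the lower one should continue
    rcases lt_or_gt_of_ne (fun h' : (i : ℕ) = i' => hne (Fin.ext h')) with hlt | hlt
    · have := hdown (τ i) ((i' : ℕ) - (i : ℕ) - 1) ⟨(i : ℕ) + 1, by omega⟩ ⟨(i' : ℕ) + 1, by omega⟩
        (by simp; omega) (by simp) (by
          rw [h, hτS i']
          intro h'; have := congrArg (fun x => ((x.2 : Fin (m+1)) : ℕ)) h'; simp at this)
      rw [hτS i] at this
      simp at this
    · have := hdown (τ i') ((i : ℕ) - (i' : ℕ) - 1) ⟨(i' : ℕ) + 1, by omega⟩ ⟨(i : ℕ) + 1, by omega⟩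
        (by simp; omega) (by simp) (by
          rw [← h, hτS i]
          intro h'; have := congrArg (fun x => ((x.2 : Fin (m+1)) : ℕ)) h'; simp at this)
      rw [hτS i'] at this
      simp at this
  let τe : Equiv.Perm (Fin m) := Equiv.ofBijective τ ⟨hτinj, Finite.surjective_of_injective hτinj⟩
  refine ⟨τe.symm, fun j t => ?_⟩
  -- `σ j = τe.symm j` is the row exited by group `j`: `τ (σ j) = j`
  have hστ : τ (τe.symm j) = j := by
    show τe (τe.symm j) = j
    exact Equiv.apply_symm_apply τe j
  have hexitj : S (j, ⟨(τe.symm j : ℕ) + 1, by omega⟩) = (τe.symm j, 0) := by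
    have := hτS (τe.symm j); rwa [hστ] at this
  have hexit_ne : S (j, ⟨(τe.symm j : ℕ) + 1, by omega⟩) ≠ (j, ⟨(τe.symm j : ℕ) + 1, by omega⟩) := by
    rw [hexitj]; intro h'; have := congrArg (fun x => ((x.2 : Fin (m+1)) : ℕ)) h'; simp at this
  refine ⟨fun ht => ?_, fun ht hle => ?_, fun ht => ?_, fun ht => ?_⟩
  · rcases hcase (j, t) with ⟨_, h2, h3⟩ | ⟨h1, _⟩ | ⟨h1, _⟩ | ⟨h1, _⟩
    · exact ⟨h2, h3⟩
    all_goals exact absurd ht h1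
  · exact hdown j ((τe.symm j : ℕ) - (t : ℕ)) t ⟨(τe.symm j : ℕ) + 1, by omega⟩ (by simp; omega) (by omega) hexit_ne
  · have : t = ⟨(τe.symm j : ℕ) + 1, by omega⟩ := Fin.ext (by simp; exact ht)
    rw [this, hexitj]
  · -- above the exit everything idles: an active column would force the exit column to continue
    by_contra hact
    have h := hdown j ((t : ℕ) - (τe.symm j : ℕ) - 2) ⟨(τe.symm j : ℕ) + 1, by omega⟩ t (by simp; omega) (by simp) hact
    rw [hexitj] at h
    simp at h

/-! ## 2. The walk description: uniqueness, existence, the exit permutation is determined -/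

/-- The walk description of a permutation of `Fin m × Fin (m+1)` by an exit permutation `σ`. [folklore] -/
theorem desc_unique {S S' : Equiv.Perm (Fin m × Fin (m + 1))} {σ : Equiv.Perm (Fin m)}
    (hS : ∀ j : Fin m, ∀ t : Fin (m + 1),
      ((t : ℕ) = 0 → (S (j, t)).1 = j ∧ ((S (j, t)).2 : ℕ) = 1) ∧
      ((t : ℕ) ≠ 0 → (t : ℕ) ≤ (σ j : ℕ) → (S (j, t)).1 = j ∧ ((S (j, t)).2 : ℕ) = (t : ℕ) + 1) ∧
      ((t : ℕ) = (σ j : ℕ) + 1 → S (j, t) = (σ j, 0)) ∧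
      ((σ j : ℕ) + 1 < (t : ℕ) → S (j, t) = (j, t)))
    (hS' : ∀ j : Fin m, ∀ t : Fin (m + 1),
      ((t : ℕ) = 0 → (S' (j, t)).1 = j ∧ ((S' (j, t)).2 : ℕ) = 1) ∧
      ((t : ℕ) ≠ 0 → (t : ℕ) ≤ (σ j : ℕ) → (S' (j, t)).1 = j ∧ ((S' (j, t)).2 : ℕ) = (t : ℕ) + 1) ∧
      ((t : ℕ) = (σ j : ℕ) + 1 → S' (j, t) = (σ j, 0)) ∧
      ((σ j : ℕ) + 1 < (t : ℕ) → S' (j, t) = (j, t))) : S = S' := by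
  ext ⟨j, t⟩ : 1
  obtain ⟨a1, a2, a3, a4⟩ := hS j t
  obtain ⟨b1, b2, b3, b4⟩ := hS' j t
  by_cases h0 : (t : ℕ) = 0
  · obtain ⟨x1, x2⟩ := a1 h0; obtain ⟨y1, y2⟩ := b1 h0
    exact Prod.ext (x1.trans y1.symm) (Fin.ext (x2.trans y2.symm))
  by_cases h1 : (t : ℕ) ≤ (σ j : ℕ)
  · obtain ⟨x1, x2⟩ := a2 h0 h1; obtain ⟨y1, y2⟩ := b2 h0 h1
    exact Prod.ext (x1.trans y1.symm) (Fin.ext (x2.trans y2.symm))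
  by_cases h2 : (t : ℕ) = (σ j : ℕ) + 1
  · rw [a3 h2, b3 h2]
  · have h3 : (σ j : ℕ) + 1 < (t : ℕ) := by omega
    rw [a4 h3, b4 h3]

/-- the exit permutation is determined by the walk. [folklore] -/
theorem sigma_unique {S : Equiv.Perm (Fin m × Fin (m + 1))} {σ σ' : Equiv.Perm (Fin m)}
    (hS : ∀ j : Fin m, ∀ t : Fin (m + 1),
      ((t : ℕ) = 0 → (S (j, t)).1 = j ∧ ((S (j, t)).2 : ℕ) = 1) ∧
      ((t : ℕ) ≠ 0 → (t : ℕ) ≤ (σ j : ℕ) → (S (j, t)).1 = j ∧ ((S (j, t)).2 : ℕ) = (t : ℕ) + 1) ∧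
      ((t : ℕ) = (σ j : ℕ) + 1 → S (j, t) = (σ j, 0)) ∧
      ((σ j : ℕ) + 1 < (t : ℕ) → S (j, t) = (j, t)))
    (hS' : ∀ j : Fin m, ∀ t : Fin (m + 1),
      ((t : ℕ) = 0 → (S (j, t)).1 = j ∧ ((S (j, t)).2 : ℕ) = 1) ∧
      ((t : ℕ) ≠ 0 → (t : ℕ) ≤ (σ' j : ℕ) → (S (j, t)).1 = j ∧ ((S (j, t)).2 : ℕ) = (t : ℕ) + 1) ∧
      ((t : ℕ) = (σ' j : ℕ) + 1 → S (j, t) = (σ' j, 0)) ∧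
      ((σ' j : ℕ) + 1 < (t : ℕ) → S (j, t) = (j, t))) : σ = σ' := by
  ext j : 1
  -- the exit column of `σ` at group `j`
  set t : Fin (m + 1) := ⟨(σ j : ℕ) + 1, by omega⟩ with ht
  have hx : S (j, t) = (σ j, 0) := (hS j t).2.2.1 (by simp [ht])
  obtain ⟨b1, b2, b3, b4⟩ := hS' j t
  by_contra hne
  rcases Nat.lt_or_gt_of_ne (fun h : (σ j : ℕ) = (σ' j : ℕ) => hne (Fin.ext h)) with hlt | hgt
  · -- `t ≤ σ' j`: the column continues under `σ'`
    obtain ⟨_, y2⟩ := b2 (by simp [ht]) (by simp [ht]; omega)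
    rw [hx] at y2
    simp at y2
  · -- `σ' j + 1 < t`: the column idles under `σ'`
    have y := b4 (by simp [ht]; omega)
    rw [hx] at y
    have := congrArg (fun x => ((x.2 : Fin (m + 1)) : ℕ)) y
    simp [ht] at this

/-- **Existence of the walk** of a permutation `σ`: an explicit successor function is injective, hence a permutation. [folklore] -/
theorem desc_exists (σ : Equiv.Perm (Fin m)) : ∃ S : Equiv.Perm (Fin m × Fin (m + 1)), ∀ j : Fin m, ∀ t : Fin (m + 1),
      ((t : ℕ) = 0 → (S (j, t)).1 = j ∧ ((S (j, t)).2 : ℕ) = 1) ∧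
      ((t : ℕ) ≠ 0 → (t : ℕ) ≤ (σ j : ℕ) → (S (j, t)).1 = j ∧ ((S (j, t)).2 : ℕ) = (t : ℕ) + 1) ∧
      ((t : ℕ) = (σ j : ℕ) + 1 → S (j, t) = (σ j, 0)) ∧
      ((σ j : ℕ) + 1 < (t : ℕ) → S (j, t) = (j, t)) := by
  -- the successor function (an opaque local constant with its defining equation)
  obtain ⟨F, hF⟩ : ∃ F : Fin m × Fin (m + 1) → Fin m × Fin (m + 1), ∀ x, F x =
      (if (x.2 : ℕ) = 0 then (x.1, ⟨1 % (m + 1), Nat.mod_lt _ (Nat.succ_pos m)⟩)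
       else if (x.2 : ℕ) ≤ (σ x.1 : ℕ) then (x.1, ⟨((x.2 : ℕ) + 1) % (m + 1), Nat.mod_lt _ (Nat.succ_pos m)⟩)
       else if (x.2 : ℕ) = (σ x.1 : ℕ) + 1 then (σ x.1, 0) else x) := ⟨_, fun x => rfl⟩
  have hm : ∀ j : Fin m, 1 % (m + 1) = 1 := fun j => Nat.mod_eq_of_lt (by have := j.isLt; omega)
  -- values of `F`
  have hF0 : ∀ (j : Fin m) (t : Fin (m + 1)), (t : ℕ) = 0 →
      F (j, t) = (j, ⟨1 % (m + 1), Nat.mod_lt _ (Nat.succ_pos m)⟩) := by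
    intro j t h; rw [hF]; dsimp only; rw [if_pos h]
  have hF1 : ∀ (j : Fin m) (t : Fin (m + 1)), (t : ℕ) ≠ 0 → (t : ℕ) ≤ (σ j : ℕ) →
      F (j, t) = (j, ⟨((t : ℕ) + 1) % (m + 1), Nat.mod_lt _ (Nat.succ_pos m)⟩) := by
    intro j t h h'; rw [hF]; dsimp only; rw [if_neg h, if_pos h']
  have hF2 : ∀ (j : Fin m) (t : Fin (m + 1)), (t : ℕ) = (σ j : ℕ) + 1 → F (j, t) = (σ j, 0) := by
    intro j t h
    have h1 : (t : ℕ) ≠ 0 := by omega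
    have h2 : ¬ ((t : ℕ) ≤ (σ j : ℕ)) := by omega
    rw [hF]; dsimp only; rw [if_neg h1, if_neg h2, if_pos h]
  have hF3 : ∀ (j : Fin m) (t : Fin (m + 1)), (σ j : ℕ) + 1 < (t : ℕ) → F (j, t) = (j, t) := by
    intro j t h
    have h1 : (t : ℕ) ≠ 0 := by omega
    have h2 : ¬ ((t : ℕ) ≤ (σ j : ℕ)) := by omega
    have h3 : (t : ℕ) ≠ (σ j : ℕ) + 1 := by omega
    rw [hF]; dsimp only; rw [if_neg h1, if_neg h2, if_neg h3]
  -- second coordinates of the values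
  have hsnd : ∀ (j : Fin m) (t : Fin (m + 1)),
      ((t : ℕ) = 0 → ((F (j, t)).2 : ℕ) = 1 ∧ (F (j, t)).1 = j) ∧
      ((t : ℕ) ≠ 0 → (t : ℕ) ≤ (σ j : ℕ) → ((F (j, t)).2 : ℕ) = (t : ℕ) + 1 ∧ (F (j, t)).1 = j) ∧
      ((t : ℕ) = (σ j : ℕ) + 1 → ((F (j, t)).2 : ℕ) = 0 ∧ (F (j, t)).1 = σ j) ∧
      ((σ j : ℕ) + 1 < (t : ℕ) → ((F (j, t)).2 : ℕ) = t ∧ (F (j, t)).1 = j) := by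
    intro j t
    refine ⟨fun h => ?_, fun h h' => ?_, fun h => ?_, fun h => ?_⟩
    · rw [hF0 j t h]; exact ⟨hm j, rfl⟩
    · rw [hF1 j t h h']
      refine ⟨?_, rfl⟩
      show ((t : ℕ) + 1) % (m + 1) = (t : ℕ) + 1
      exact Nat.mod_eq_of_lt (by have := (σ j).isLt; omega)
    · rw [hF2 j t h]; exact ⟨rfl, rfl⟩
    · rw [hF3 j t h]; exact ⟨rfl, rfl⟩
  -- injectivity
  have hinj : Function.Injective F := by
    rintro ⟨j, t⟩ ⟨j', t'⟩ hEq
    obtain ⟨a0, a1, a2, a3⟩ := hsnd j t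
    obtain ⟨b0, b1, b2, b3⟩ := hsnd j' t'
    have e2 : ((F (j, t)).2 : ℕ) = ((F (j', t')).2 : ℕ) := by rw [hEq]
    have e1 : (F (j, t)).1 = (F (j', t')).1 := by rw [hEq]
    -- classify `t` and `t'`
    rcases Nat.eq_zero_or_pos (t : ℕ) with ht | ht
    · obtain ⟨x2, x1⟩ := a0 ht
      rcases Nat.eq_zero_or_pos (t' : ℕ) with ht' | ht'
      · obtain ⟨y2, y1⟩ := b0 ht'
        have hte : (t : ℕ) = (t' : ℕ) := by omega
        exact Prod.ext (x1.symm.trans (e1.trans y1)) (Fin.ext hte)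
      · by_cases h1 : (t' : ℕ) ≤ (σ j' : ℕ)
        · obtain ⟨y2, _⟩ := b1 (by omega) h1; omega
        · by_cases h2 : (t' : ℕ) = (σ j' : ℕ) + 1
          · obtain ⟨y2, _⟩ := b2 h2; omega
          · obtain ⟨y2, _⟩ := b3 (by omega); omega
    · by_cases h1 : (t : ℕ) ≤ (σ j : ℕ)
      · obtain ⟨x2, x1⟩ := a1 (by omega) h1
        rcases Nat.eq_zero_or_pos (t' : ℕ) with ht' | ht'
        · obtain ⟨y2, _⟩ := b0 ht'; omega
        · by_cases h1' : (t' : ℕ) ≤ (σ j' : ℕ)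
          · obtain ⟨y2, y1⟩ := b1 (by omega) h1'
            have hte : (t : ℕ) = (t' : ℕ) := by omega
            exact Prod.ext (x1.symm.trans (e1.trans y1)) (Fin.ext hte)
          · by_cases h2' : (t' : ℕ) = (σ j' : ℕ) + 1
            · obtain ⟨y2, _⟩ := b2 h2'; omega
            · obtain ⟨y2, y1⟩ := b3 (by omega)
              have hj : j = j' := x1.symm.trans (e1.trans y1)
              subst hj
              exfalso; omega
      · by_cases h2 : (t : ℕ) = (σ j : ℕ) + 1
        · obtain ⟨x2, x1⟩ := a2 h2
          rcases Nat.eq_zero_or_pos (t' : ℕ) with ht' | ht'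
          · obtain ⟨y2, _⟩ := b0 ht'; omega
          · by_cases h1' : (t' : ℕ) ≤ (σ j' : ℕ)
            · obtain ⟨y2, _⟩ := b1 (by omega) h1'; omega
            · by_cases h2' : (t' : ℕ) = (σ j' : ℕ) + 1
              · obtain ⟨_, y1⟩ := b2 h2'
                have hj : j = j' := σ.injective (x1.symm.trans (e1.trans y1))
                subst hj
                have hte : (t : ℕ) = (t' : ℕ) := by omega
                exact Prod.ext rfl (Fin.ext hte)
              · obtain ⟨y2, _⟩ := b3 (by omega); omega
        · have h3 : (σ j : ℕ) + 1 < (t : ℕ) := by omega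
          obtain ⟨x2, x1⟩ := a3 h3
          rcases Nat.eq_zero_or_pos (t' : ℕ) with ht' | ht'
          · obtain ⟨y2, _⟩ := b0 ht'; omega
          · by_cases h1' : (t' : ℕ) ≤ (σ j' : ℕ)
            · obtain ⟨y2, y1⟩ := b1 (by omega) h1'
              have hj : j = j' := x1.symm.trans (e1.trans y1)
              subst hj
              exfalso; omega
            · by_cases h2' : (t' : ℕ) = (σ j' : ℕ) + 1
              · obtain ⟨y2, _⟩ := b2 h2'; omega
              · obtain ⟨y2, y1⟩ := b3 (by omega)
                have hte : (t : ℕ) = (t' : ℕ) := by omega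
                exact Prod.ext (x1.symm.trans (e1.trans y1)) (Fin.ext hte)
  refine ⟨Equiv.ofBijective F ⟨hinj, Finite.surjective_of_injective hinj⟩, fun j t => ?_⟩
  rw [Equiv.ofBijective_apply]
  obtain ⟨a0, a1, a2, a3⟩ := hsnd j t
  refine ⟨fun h => ⟨(a0 h).2, (a0 h).1⟩, fun h h' => ⟨(a1 h h').2, (a1 h h').1⟩, fun h => hF2 j t h, fun h => hF3 j t h⟩

end ColumnFanout

end Summit.ValiantsHypothesis.ValiantsHypothesis.Theorems.KPlusLogSqLaw
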